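import Summits.HodgeConjecture.HodgeConjecture.Theses.NikulinTwinTransport
import Literature.AlgebraicGeometry.Surfaces.K3Surface
import Literature.AlgebraicGeometry.Surfaces.K3NikulinInvolution
import Literature.AlgebraicGeometry.HodgeTheory.AnalytifiedVectorBundle
import Literature.AlgebraicGeometry.HodgeTheory.KaehlerClassHodgeType
import Literature.AlgebraicGeometry.HodgeTheory.ChernCharacterBetti
import Literature.Geometry.Hyperkaehler.Hyperholomorphic

/-!
# Typed transcription of the informal crux `NikulinSerreCarrier` (stmt-HodgeConjecture-14464, K1)

The route item `NikulinTwinTransport.NikulinSerreCarrier` is INFORMAL (signature `null`; the route file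
carries it only as a comment), so no line skeleton can conclude it by name.  This work-file gives a
TYPED TRANSCRIPTION `NikulinSerreCarrier : Prop` over existing declarations only, written by the
crux-plan planner (planner-cruxplan-stmt-HodgeConjecture-14464-modular-twin-address-0, 2026-08-16, v2) so
that `Lines/*.lean` skeletons can be audited with
`ledger skeleton check … --crux-decl Summit.HodgeConjecture.HodgeConjecture.Cruxes.NikulinSerreCarrier.NikulinSerreCarrier`.
It is OFFERED to the route's planner as the item signature (set-signature is a route-level decision:
the route file's import cone would have to grow by the imports above).

## Reading of the informal text, clause by clause

* QUANTIFIER SHAPE (v2).  The route needs ONE anchor: a twin pair `(X, Y)` of the completed Nikulin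
  2-similitude `Ψ` at which `graph Ψ` is algebraic and a carrier exists; K2 transports from there to
  every twin pair (twistor connectivity).  The route's own "NOT DECOMPOSED YET" leaves "the choice of
  Nikulin family (degree `2d`, absence of `(−2)`-walls)" free.  Hence the anchor is EXISTENTIAL here
  (`∃ X Y ι N h r Ψ …`), under `∀ μ` (orientation family with Poincaré duality) and
  `∀ C : ChernCharacterBetti` (the tree's hypothesis-structure idiom, as in `TwinSimilitudeAlgebraic`).
  (v1 of this file quantified the anchor universally — stronger than the route needs; superseded.)
* DATA.  `X` projective K3 (`IsK3Surface`) with a Nikulin involution `ι` (`IsNikulinInvolution`);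
  `Y` (= `Y′`) a projective K3; integral generators `pX, pY` of `H⁴`; the eight nodal classes
  `N j ∈ H²(Y)` (integral, algebraic, `(Nᵢ.Nⱼ) = −2δᵢⱼ`, even eight `½ΣNⱼ` integral); the class `h`
  (integral, algebraic, `h ⊥ Nⱼ`, `h² = 2d > 0`); the eight roots `r j ∈ E₈(−2) ⊂ NS(X)` (integral,
  algebraic, `ι^* rⱼ = −rⱼ`, `(rᵢ.rⱼ) = −4δᵢⱼ`); the completed similitude `Ψ : H²(Y) → H²(X)`
  (rational, Hodge-type preserving, `(Ψx.Ψy) = 2(x.y)`, bijective, `Ψ Nⱼ = rⱼ`, `ι^*`-invariant on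
  `N^⊥`), ALGEBRAIC AT THE ANCHOR: `Ψ = [γ₀]_*` for an algebraic `γ₀` on `X ⊗ Y`, in the route's
  convention `[γ]_* x = fst_*(snd^* x ∪ γ)` of `TwinSimilitudeAlgebraic`.  The geometric origin of
  `(Y, Ψ)` (`Y′ = res(X/ι)`, `Ψ = g^*` on `N^⊥`) and the genericity of `X` are NOT restated: in the
  existential form they would only burden the constructor, and the route consumes exactly the listed
  cohomological properties.
* FRAME.  `ω′ = h − Σ εⱼ Nⱼ`, `εⱼ > 0`, `ω = Ψ ω′`.  The informal "small" is descriptive (it makes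
  `ω′` ample); this is the EXISTENTIAL frame form K1∃ — one admissible frame suffices for K2 — and the
  Kähler property of `ω ⊞ ω′` is forced by the conclusion (it is the Kähler class of a hyperkähler
  metric).  The reading "for ALL small ε" (K1∀) is strictly stronger and is NOT typed here.
* CARRIER.  "slope-POLYSTABLE (w.r.t. `ω ⊞ ω′`) reflexive — ideally locally free — sheaf `G` on
  `X × Y′` with `c₁(G)` `SU(2)`-invariant (e.g. `0`) and `c₂(G)^{(2,2)} = m·graph(Ψ)`, `m ≠ 0`" is typed
  as: an algebraic VECTOR BUNDLE `G` on `X ⊗ Y` (locally free: the "ideal" case; GAGA makes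
  analytic = algebraic) with `ch₁(G) = 0` (the "e.g. 0" choice; in a generic frame invariance forces
  it, Disproof §D) whose `ch₂` acts as `−m·Ψ` (`c₂ = −ch₂` when `c₁ = 0`; the action extracts exactly
  the `(2,2)` Künneth component), `m ∈ ℤ ∖ 0`, and whose analytification over a Hodge model of
  `X ⊗ Y` carries a HYPERHOLOMORPHIC Chern connection (`HasHyperholomorphicConnection`) for a
  hyperkähler triple (`IsHyperkaehlerTriple`) whose Kähler class is `ω ⊞ ω′`.  By Verbitsky
  (Thm. 2.3: hyperholomorphic ⇒ Yang–Mills; Thm. 2.5 + Uhlenbeck–Yau/Kobayashi–Lübke: polystable with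
  invariant `c₁, c₂` ⇒ hyperholomorphic) this is "polystable w.r.t. `ω ⊞ ω′` with invariant `c₁, c₂`",
  and it is the form crux K2 (`TwinTwistorTransport`) consumes.  The Ψ-matching of the phases of
  `J, K` is not imposed: it is forced (a bundle with `ch₂` acting as `−mΨ ≠ 0` on `T` can only be
  hyperholomorphic for the matched diagonal `SU(2)`), and the metric is the product Ricci-flat one by
  Calabi–Yau uniqueness.
* KNOWN CONSTRAINTS honoured (Disproof.lean / item notes): `m` even and `Ψ` only rational with `2Ψ`
  integral (K1-integrality note; here `Ψ` is rational, no integrality claimed); sign law `m > 0` (§C)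
  not imposed; the frame keeps `εⱼ > 0` (FRAME PINNING, `Theorems/NikulinSerreCarrier/Negative/
  InvariantCarrierPinned`: an ι-invariant `ω` is route-useless).

STRENGTH relative to the informal K1: locally free instead of reflexive (stronger ∃-claim); `c₁ = 0`
instead of "invariant" (equivalent in generic frames); K1∃ instead of K1∀ (weaker, see FRAME);
existential anchor (what the route consumes).
-/

open scoped Manifold ContDiff
open CategoryTheory MonoidalCategory
open Literature.AlgebraicGeometry Literature.AlgebraicGeometry.HodgeTheory
open Literature.AlgebraicGeometry.Surfaces Literature.AlgebraicGeometry.Motives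
open Literature.AlgebraicTopology.SingularHomology
open Literature.Geometry.Hyperkaehler Literature.Geometry.Kaehler
open Literature.NumberTheory.Transcendental (DeRhamIsoFamily)

namespace Summit.HodgeConjecture.HodgeConjecture.Cruxes.NikulinSerreCarrier

/-- **K1, typed (K1∃, existential anchor).**  There is a Nikulin anchor `(X, ι, Y, N, h, r, Ψ)` as in the
module docstring, with `Ψ` algebraic at the anchor, a frame `εⱼ > 0`, `ω′ = h − Σ εⱼNⱼ`, `ω = Ψ ω′`, and an
algebraic vector bundle `G` on `X ⊗ Y` with `ch₁(G) = 0`, `[ch₂(G)]_* = −m·Ψ` (`m ∈ ℤ ∖ 0`) whose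
analytification admits a hyperholomorphic Chern connection for a hyperkähler structure on `(X ⊗ Y)^an` with
Kähler class `ω ⊞ ω′`. -/
def NikulinSerreCarrier : Prop :=
  ∀ (μ : OrientationFamily), μ.HasPoincareDuality → ∀ (C : ChernCharacterBetti),
    ∃ (X Y : SchemeOver ℂ) (hX : IsK3Surface X) (hY : IsK3Surface Y)
      (pX : complexBetti X (2 * 2)) (pY : complexBetti Y (2 * 2)) (ι : X ⟶ X)
      (N : Fin 8 → complexBetti Y (2 * 1)) (h : complexBetti Y (2 * 1)) (r : Fin 8 → complexBetti X (2 * 1))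
      (Ψ : complexBetti Y (2 * 1) →ₗ[ℂ] complexBetti X (2 * 1)),
      -- X carries the Nikulin involution ι; pX, pY are integral generators of H⁴
      IsNikulinInvolution X ι ∧
      (IsIntegralClass pX ∧ ∀ q : complexBetti X (2 * 2), IsIntegralClass q → ∃ n : ℤ, q = n • pX) ∧
      (IsIntegralClass pY ∧ ∀ q : complexBetti Y (2 * 2), IsIntegralClass q → ∃ n : ℤ, q = n • pY) ∧
      -- the eight nodal classes and the even eight
      (∀ j, IsIntegralClass (N j) ∧ N j ∈ algebraicClasses Y 1) ∧
      (∀ i j, cupProduct (rfl : 2 * 1 + 2 * 1 = 2 * 2) (N i) (N j) =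
        (if i = j then (-2 : ℂ) else 0) • pY) ∧
      IsIntegralClass ((1 / 2 : ℂ) • ∑ j, N j) ∧
      -- the class h (pull-back of an ample class of X/ι): integral, algebraic, h ⊥ Nⱼ, h² = 2d > 0
      (IsIntegralClass h ∧ h ∈ algebraicClasses Y 1) ∧
      (∀ j, cupProduct (rfl : 2 * 1 + 2 * 1 = 2 * 2) h (N j) = 0) ∧
      (∃ d : ℕ, 0 < d ∧ cupProduct (rfl : 2 * 1 + 2 * 1 = 2 * 2) h h = ((2 * d : ℕ) : ℂ) • pY) ∧
      -- the eight roots rⱼ of E₈(−2) ⊂ NS(X): integral, algebraic, ι-anti-invariant, (rᵢ.rⱼ) = −4δᵢⱼ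
      (∀ j, IsIntegralClass (r j) ∧ r j ∈ algebraicClasses X 1 ∧
        complexBetti.map ι (2 * 1) (r j) = -r j) ∧
      (∀ i j, cupProduct (rfl : 2 * 1 + 2 * 1 = 2 * 2) (r i) (r j) =
        (if i = j then (-4 : ℂ) else 0) • pX) ∧
      -- the completed Nikulin 2-similitude Ψ: rational, type-preserving, (Ψx.Ψy) = 2(x.y), bijective,
      -- Ψ Nⱼ = rⱼ, ι^*-invariant on N^⊥ (= g^* there)
      (∀ x, IsRationalClass x → IsRationalClass (Ψ x)) ∧
      (∀ (i j : ℕ) (x : complexBetti Y (2 * 1)),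
        IsOfHodgeType 2 Y (2 * 1) i j x → IsOfHodgeType 2 X (2 * 1) i j (Ψ x)) ∧
      (∀ (x y : complexBetti Y (2 * 1)) (a : ℂ),
        cupProduct (rfl : 2 * 1 + 2 * 1 = 2 * 2) x y = a • pY →
        cupProduct (rfl : 2 * 1 + 2 * 1 = 2 * 2) (Ψ x) (Ψ y) = ((2 : ℂ) * a) • pX) ∧
      Function.Bijective Ψ ∧
      (∀ j, Ψ (N j) = r j) ∧
      (∀ x : complexBetti Y (2 * 1), (∀ j, cupProduct (rfl : 2 * 1 + 2 * 1 = 2 * 2) x (N j) = 0) →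
        complexBetti.map ι (2 * 1) (Ψ x) = Ψ x) ∧
      -- ALGEBRAIC AT THE ANCHOR: Ψ = [γ₀]_* for an algebraic class γ₀ on X ⊗ Y
      (∃ γ₀ ∈ algebraicClasses (X ⊗ Y) 2, ∀ x : complexBetti Y (2 * 1),
        Ψ x = complexGysin μ (IsSmoothProjective.tensor_holds hX.1 hY.1) hX.1
          (SemiCartesianMonoidalCategory.fst X Y)
          (rfl : 2 * 1 + 2 * 2 + 2 * 2 = 2 * 1 + 2 * (2 + 2))
          (cupProduct (rfl : 2 * 1 + 2 * 2 = 2 * 1 + 2 * 2)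
            (complexBetti.map (SemiCartesianMonoidalCategory.snd X Y) (2 * 1) x) γ₀)) ∧
      ∃ ε : Fin 8 → ℝ, (∀ j, 0 < ε j) ∧
      ∃ ω' : complexBetti Y (2 * 1), ω' = h - ∑ j, ((ε j : ℝ) : ℂ) • N j ∧
      ∃ (G : (X ⊗ Y).left.Modules) (rk : ℕ), IsVectorBundle G ∧ C.ch (X ⊗ Y) G 1 = 0 ∧
        (∃ m : ℤ, m ≠ 0 ∧ ∀ y : complexBetti Y (2 * 1),
          complexGysin μ (IsSmoothProjective.tensor_holds hX.1 hY.1) hX.1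
            (SemiCartesianMonoidalCategory.fst X Y)
            (rfl : 2 * 1 + 2 * 2 + 2 * 2 = 2 * 1 + 2 * (2 + 2))
            (cupProduct (rfl : 2 * 1 + 2 * 2 = 2 * 1 + 2 * 2)
              (complexBetti.map (SemiCartesianMonoidalCategory.snd X Y) (2 * 1) y)
              (C.ch (X ⊗ Y) G 2)) =
          (-(m : ℂ)) • Ψ y) ∧
        ∃ (A : HodgeModel (2 + 2) (X ⊗ Y))
          (𝓕 : AnalytifiedVectorBundle 𝓘(ℂ, A.model) (EuclideanSpace ℂ (Fin rk)) A.toComplexPoints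
            G)
          (gm : Bundle.ContMDiffRiemannianMetric 𝓘(ℝ, A.model) ∞ A.model
            (fun x : A.carrier ↦ TangentSpace 𝓘(ℝ, A.model) x))
          (J K : ∀ x : A.carrier, TangentSpace 𝓘(ℝ, A.model) x →L[ℝ] TangentSpace 𝓘(ℝ, A.model) x)
          (hHK : IsHyperkaehlerTriple gm.toRiemannianMetric J K)
          (hω : isSmoothForm_kaehlerForm_of_isManifold_complex (E := A.model) (M := A.carrier))
          (e : DeRhamIsoFamily 𝓘(ℝ, A.model)),
          e.IsNatural ∧
          A.pullback 2
              (complexBetti.map (SemiCartesianMonoidalCategory.fst X Y) (2 * 1) (Ψ ω') +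
                complexBetti.map (SemiCartesianMonoidalCategory.snd X Y) (2 * 1) (ω')) =
            ofRealClass A.carrier 2 (e A.carrier 2 (gm.kaehlerClass hω hHK.isKaehler)) ∧
          HasHyperholomorphicConnection (EuclideanSpace ℂ (Fin rk)) 𝓕.bundle J K

end Summit.HodgeConjecture.HodgeConjecture.Cruxes.NikulinSerreCarrier
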